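/-
Copyright (c) 2026. All rights reserved.
Released under Apache 2.0 license as described in the file LICENSE.
-/
import Mathlib
import Literature.Algebra.Polynomial.GramMatrixMethod
import Literature.Algebra.Polynomial.NewtonPolytope
import Literature.LinearAlgebra.Matrix.FactorWidthTwo
import HarnessLib

/-!
# Simplification of sum-of-squares programs: zero diagonal, sign symmetries, and an exact
# post-processing certificate

Topic `Algebra/Polynomial`; namespace `Literature.Algebra.Polynomial.SosProgramSimplification`.
Everything below is PROVED (no named fact, no placeholder proof, no instance, no notation).

A sum-of-squares (SOS) program searches for `p = z_Sᵀ Q z_S`, `Q ⪰ 0`, over a finite set `S` of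
candidate exponents (`GramMatrixMethod`: `gramPoly`, `monomialVec`, Laurent's Lemma 3.8).  Its size
is `|S|`, so implementations (YALMIP [Lofberg2009], SOSOPT [SeilerZhengBalas2013]) PRE-process `S`
and POST-process the numerical `Q`.  This file proves the soundness statements behind three such
steps which the tree did not yet have (the Newton polytope itself is `NewtonPolytope.lean`,
symmetry reduction by a general finite group is `Computability/Complexity/SumOfSquaresSymmetry.lean`
and `Analysis/Convex/SymmetryAdaptedBlockDiagonalization.lean`, coefficient-budget absorption of a
numerical remainder is `SosPerturbationAbsorption.lean`):

* §1 **Zero diagonal / diagonal inconsistency** [SeilerZhengBalas2013, §4 Lemma 1, Lemma 2,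
  Theorem 3; Lofberg2009, §III-B Theorem 2].  Löfberg: «If a squared candidate monomial is not a
  term in `f(x)`, and the squared monomial only is generated by squaring said monomial, it cannot be
  (a non-zero) part of the decomposition. … Theorem 2: A candidate monomial `x^{sᵢ}` is redundant in
  a sum-of-squares decomposition of a polynomial `f(x)` with support in `x^{p_j}` if
  `∄ (k, j ≠ i, l ≠ i) : {2sᵢ = p_k, 2sᵢ = s_l + s_j}`. … Note that the reduction can be applied
  iteratively.»  Seiler–Zheng–Balas: «Lemma 1. If `S_{2αᵢ} = {(i,i)}` then `Q_{i,i} = c_{2αᵢ}` if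
  `2αᵢ ∈ 𝒜`, `0` if `2αᵢ ∉ 𝒜`.  Lemma 2. If `p = zᵀQz`, `Q ⪰ 0`, and `Q_{i,i} = 0` then
  `p = z̃ᵀ Q̃ z̃` where `z̃` … is obtained by deleting the `i`th element of `z` … Theorem 3. The
  zero diagonal algorithm terminates …, and `M_{k_f} ⊆ ½C(p) ∩ ℕⁿ`. Moreover, if `p = Σᵢ fᵢ²` then
  `C(fᵢ) ∩ ℕⁿ ⊆ M_{k_f}`» (proof: «Induction can be used to show `C(fᵢ) ∩ ℕⁿ ⊆ M_k` holds after
  each step `k`»).  Here: `UniqueSq S α` (`2α` arises in `S + S` only as `α + α`),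
  `coeff_add_self_mul_of_uniqueSq` / `coeff_add_self_sum_mul_self_of_uniqueSq` (then
  `p_{2α} = Σ_j (u_j)_α²`, Lemma 1 at the level of the squares), `gram_diag_eq_coeff_of_uniqueSq`
  (Lemma 1 for a Gram matrix), `coeff_eq_zero_of_sum_mul_self_eq` and
  `support_subset_erase_of_sum_mul_self_eq` (Theorem 2 / Lemma 2: `p_{2α} = 0` forces `(u_j)_α = 0`,
  so `α` may be deleted), the ITERATION `IsPruningSeq` / `pruneBasis` with
  `support_subset_pruneBasis` (Theorem 3, last clause), and the reduced Gram program
  `exists_posSemidef_gram_pruneBasis` (over `ℝ`: the pruned SDP is still feasible).  (The matrix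
  fact behind Lemma 2 — `Q ⪰ 0`, `Q_ii = 0` ⇒ row `i` of `Q` vanishes — is the tree's
  `Computation/Certificates/PsdZeroPivotRule.lean`; here Lemma 2 is proved at the level of the
  squares `u_j`, which is what the pruning argument uses.)
* §2 **A zero-diagonal fixed point lies inside the half Newton polytope**
  [SeilerZhengBalas2013, §4 Theorem 3, the clause `M_{k_f} ⊆ ½ C(p)`]: if every `α ∈ M` with
  `UniqueSq M α` has `p_{2α} ≠ 0`, then `M ⊆ ½ N(p)`
  (`exponentPt_mem_half_newtonPolytope_of_closed`; proof as printed: a vertex `α` of `conv M` has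
  `S_{2α} = {(α,α)}`, hence `2α ∈ supp p`).
* §3 **Sign symmetries and block diagonalisation** [Lofberg2009, §III-C Definition 1, Theorem 3,
  (1)–(2), (6)].  «Definition 1: The sign-symmetries of a polynomial `f(x)` with support in the
  monomials `x^{pᵢ}` are defined by all vectors `rᵢ` such that `rᵢ ∈ {0,1}ⁿ`, `rᵢᵀ P = 0 (mod 2)`.»
  «it has to hold `v_eᵀ(x) Q₁₂ v_o(x) = 0`. If there exist a decomposition with `Q ⪰ 0`, changing
  `Q₁₂` to zero still yields `Q ⪰ 0` … there is no loss in generality to use a block diagonal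
  decomposition», «Theorem 3: … Let `W = RᵀS`. The candidate monomials can be block partitioned into
  `q` blocks … `wᵢ = w_j (mod 2) ⇔ i, j ∈ I_k`.»  Here, with Mathlib's weighted-homogeneous
  components for the weight `signWeight r : σ → (κ → ZMod 2)` (the class `W β = Rᵀβ mod 2` of an
  exponent is `Finsupp.weight (signWeight r) β`): `IsSignSymmetric`, and the polynomial identity
  behind Theorem 3, `eq_sum_signPart_mul_self` — if `p = Σ_j u_j²` is sign-symmetric then
  `p = Σ_j Σ_c (u_j^{(c)})²`, the cross-class products cancelling — valid over any commutative
  semiring; and over `ℝ` the block SDP `exists_posSemidef_gram_blocks` (one PSD block per class,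
  eq. (6)).
* §4 **Post-processing: an exact certificate from an inexact Gram matrix** [Lofberg2009, §IV
  Theorem 4]: «Let `Q ∈ ℝ^{M×M}`, `A` and `b` be solution and data for an SDP solving the
  sum-of-squares decomposition `f(x) = v(x)ᵀQv(x)`. If `λ_min(Q) ≥ M‖A(Q) − b‖_∞`, the polynomial
  is non-negative» (proof: `f = vᵀ(Q + R)v` with the residual Gram matrix `R`, `‖R‖_∞ ≤ Mε`, so
  `Q + R ⪰ 0`).  The exact-arithmetic reading proved here replaces the spectral bound by diagonal
  dominance (tree `IsDiagDominant.posSemidef`): `posSemidef_add_of_sub_smul_one` — `Q − c·1 ⪰ 0`,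
  `R` symmetric with absolute row sums `≤ c` ⇒ `Q + R ⪰ 0` — its entrywise form
  `posSemidef_add_of_entry_le` (`|R_ij| ≤ ε`, `c = M ε`), and `isSumSq_of_gram_add_residual`
  (`p = zᵀQz + zᵀRz` is then a sum of squares).

## References
* [SeilerZhengBalas2013] P. Seiler, Q. Zheng, G. Balas, *Simplification methods for sum-of-squares
  programs*, arXiv:1303.0714 (2013), §3 (Newton polytope), §4 (zero diagonal algorithm: Lemma 1,
  Lemma 2, Theorem 3).
* [Lofberg2009] J. Löfberg, *Pre- and post-processing sum-of-squares programs in practice*, IEEE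
  Trans. Automat. Control 54 (2009) 1007–1011, §III-A Theorem 1 / Corollary 1 (Newton polytope,
  bounding box), §III-B Theorem 2 (diagonal inconsistency; «a reformulation of Proposition 3.7 in»
  Choi–Lam–Reznick, *Sums of squares of real polynomials*, 1995), §III-C Definition 1, Theorem 3
  (sign symmetries, block diagonalisation), §IV Theorem 4 (post-processing certificate).
* [Laurent2008] M. Laurent, *Sums of squares, moment matrices and optimization over polynomials*,
  §3.3 Lemma 3.8 (Gram matrix method) — through `GramMatrixMethod.lean`.
-/

namespace Literature.Algebra.Polynomial.SosProgramSimplification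

open MvPolynomial Matrix Finset
open Literature.Algebra.Polynomial.GramMatrixMethod (gramPoly monomialVec coeffMatrix
  coeff_gramPoly_monomialVec sum_mul_self_eq_gramPoly isSumSq_gramPoly_of_posSemidef monomialsLE
  support_subset_monomialsLE exists_sum_mul_self_eq_of_isSumSq_of_totalDegree_le)
open Literature.Algebra.Polynomial.NewtonPolytope (exponentPt exponentPt_injective newtonPolytope
  convex_newtonPolytope exponentPt_mem_newtonPolytope extremePoints_newtonPolytope_subset
  convexHull_extremePoints_newtonPolytope eq_of_mem_extremePoints_of_add_eq)
open scoped Pointwise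

/-! ## §1 Zero diagonal / diagonal inconsistency -/

section ZeroDiagonal

variable {R : Type*} [CommSemiring R] {σ : Type*}

/-- `UniqueSq S α`: inside `S + S` the exponent `2α` is produced only by the pair `(α, α)` —
Seiler–Zheng–Balas' condition `S_{2α} = {(i,i)}` («`x^{αᵢ} · x^{αᵢ}` is the unique decomposition of
`x^{2αᵢ}` as a product of monomials in `z`»), Löfberg's `∄ (j ≠ i, l ≠ i) : 2sᵢ = s_l + s_j`.
(If `β + γ = α + α` with `β = α` then also `γ = α`, so one equation suffices.)
[cite: SeilerZhengBalas2013, §4 Lemma 1] [cite: Lofberg2009, §III-B Theorem 2] -/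
def UniqueSq (S : Finset (σ →₀ ℕ)) (α : σ →₀ ℕ) : Prop :=
  ∀ ⦃β γ : σ →₀ ℕ⦄, β ∈ S → γ ∈ S → β + γ = α + α → β = α

/-- The second factor is then `α` as well. [cite: SeilerZhengBalas2013, §4 Lemma 1] -/
theorem UniqueSq.eq_and_eq {S : Finset (σ →₀ ℕ)} {α : σ →₀ ℕ} (hα : UniqueSq S α)
    {β γ : σ →₀ ℕ} (hβ : β ∈ S) (hγ : γ ∈ S) (h : β + γ = α + α) : β = α ∧ γ = α := by
  have hβα : β = α := hα hβ hγ h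
  refine ⟨hβα, ?_⟩
  ext i
  have hi := DFunLike.congr_fun h i
  simp only [Finsupp.add_apply, hβα] at hi
  omega

/-- `UniqueSq` is inherited by subsets. [cite: SeilerZhengBalas2013, §4 (iteration of Lemma 2)] -/
theorem UniqueSq.mono {S T : Finset (σ →₀ ℕ)} {α : σ →₀ ℕ} (hα : UniqueSq S α) (hTS : T ⊆ S) :
    UniqueSq T α :=
  fun _ _ hβ hγ h => hα (hTS hβ) (hTS hγ) h

/-- **Lemma 1 at the level of the factors**: if `u, v` are supported in `S` and `2α` arises in
`S + S` only as `α + α`, then `[X^{2α}](u v) = [X^α]u · [X^α]v`.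
[cite: SeilerZhengBalas2013, §4 Lemma 1] [cite: Lofberg2009, §III-B Theorem 2] -/
theorem coeff_add_self_mul_of_uniqueSq {S : Finset (σ →₀ ℕ)} {α : σ →₀ ℕ} (hα : UniqueSq S α)
    {u v : MvPolynomial σ R} (hu : u.support ⊆ S) (hv : v.support ⊆ S) :
    coeff (α + α) (u * v) = coeff α u * coeff α v := by
  classical
  rw [coeff_mul]
  have key : ∀ x ∈ Finset.HasAntidiagonal.antidiagonal (α + α), x ≠ (α, α) →
      coeff x.1 u * coeff x.2 v = 0 := by
    rintro ⟨β, γ⟩ hmem hne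
    have hβγ : β + γ = α + α := by simpa using hmem
    by_cases hβ : coeff β u = 0
    · rw [hβ, zero_mul]
    by_cases hγ : coeff γ v = 0
    · rw [hγ, mul_zero]
    have h := hα.eq_and_eq (hu (mem_support_iff.2 hβ)) (hv (mem_support_iff.2 hγ)) hβγ
    exact absurd (Prod.ext h.1 h.2) hne
  have hmem : (α, α) ∈ Finset.HasAntidiagonal.antidiagonal (α + α) := by simp
  exact Finset.sum_eq_single_of_mem (α, α) hmem key

/-- **`p_{2α} = Σ_j (u_j)_α²`** for `p = Σ_{j ∈ s} u_j²` with every `u_j` supported in `S` and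
`UniqueSq S α` («`p = zᵀQz` places a direct constraint on `Q_{i,i}`»).
[cite: SeilerZhengBalas2013, §4 Lemma 1] [cite: Lofberg2009, §III-B Theorem 2] -/
theorem coeff_add_self_sum_mul_self_of_uniqueSq {S : Finset (σ →₀ ℕ)} {α : σ →₀ ℕ}
    (hα : UniqueSq S α) {ι : Type*} (s : Finset ι) (u : ι → MvPolynomial σ R)
    (hu : ∀ j ∈ s, (u j).support ⊆ S) :
    coeff (α + α) (∑ j ∈ s, u j * u j) = ∑ j ∈ s, coeff α (u j) * coeff α (u j) := by
  rw [coeff_sum]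
  exact Finset.sum_congr rfl fun j hj => coeff_add_self_mul_of_uniqueSq hα (hu j hj) (hu j hj)

/-- **Lemma 1 for a Gram matrix**: if `UniqueSq S α` then the diagonal entry `Q_{αα}` of ANY Gram
matrix of `p = z_Sᵀ Q z_S` equals the coefficient `p_{2α}` (so `p_{2α} = 0` is the equation
`Q_{αα} = 0` that the zero diagonal algorithm searches for).
[cite: SeilerZhengBalas2013, §4 Lemma 1] [cite: Lofberg2009, §III-B Example 2, Theorem 2] -/
theorem gram_diag_eq_coeff_of_uniqueSq [DecidableEq σ] (S : Finset (σ →₀ ℕ)) (Q : Matrix S S R)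
    {α : S} (hα : UniqueSq S α.1) :
    Q α α = coeff (α.1 + α.1) (gramPoly Q (monomialVec S)) := by
  rw [coeff_gramPoly_monomialVec]
  symm
  rw [Finset.sum_eq_single α]
  · rw [Finset.sum_eq_single α]
    · rw [if_pos rfl]
    · intro γ _ hγ
      rw [if_neg]
      intro h
      exact hγ (Subtype.ext (hα.eq_and_eq α.2 γ.2 h).2)
    · intro h; exact absurd (Finset.mem_univ α) h
  · intro β _ hβ
    refine Finset.sum_eq_zero fun γ _ => ?_
    rw [if_neg]
    intro h
    exact hβ (Subtype.ext (hα.eq_and_eq β.2 γ.2 h).1)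
  · intro h; exact absurd (Finset.mem_univ α) h

/-! ### Iteration: the zero diagonal algorithm -/

/-- The basis left after deleting the exponents of the list `l`, in order, from `S`
(the iterates `M_k` of the zero diagonal algorithm). [cite: SeilerZhengBalas2013, §4 Theorem 3] -/
def pruneBasis [DecidableEq σ] (S : Finset (σ →₀ ℕ)) (l : List (σ →₀ ℕ)) : Finset (σ →₀ ℕ) :=
  l.foldl (fun T α => T.erase α) S

/-- `pruneBasis S [] = S`. [cite: SeilerZhengBalas2013, §4 Theorem 3] -/
@[simp] theorem pruneBasis_nil [DecidableEq σ] (S : Finset (σ →₀ ℕ)) : pruneBasis S [] = S := rfl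

/-- `pruneBasis S (α :: l) = pruneBasis (S ∖ {α}) l`. [cite: SeilerZhengBalas2013, §4 Theorem 3] -/
@[simp] theorem pruneBasis_cons [DecidableEq σ] (S : Finset (σ →₀ ℕ)) (α : σ →₀ ℕ)
    (l : List (σ →₀ ℕ)) : pruneBasis S (α :: l) = pruneBasis (S.erase α) l := rfl

/-- The pruned basis is a subset of the original one («the list of monomials returned by the zero
diagonal algorithm is never larger»). [cite: SeilerZhengBalas2013, §4 Theorem 3] -/
theorem pruneBasis_subset [DecidableEq σ] :
    ∀ (l : List (σ →₀ ℕ)) (S : Finset (σ →₀ ℕ)), pruneBasis S l ⊆ S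
  | [], S => by simp
  | α :: l, S => (pruneBasis_subset l (S.erase α)).trans (by simpa using Finset.erase_subset α S)

/-- **A run of the zero diagonal algorithm**: `IsPruningSeq p S [α₁, …, α_m]` says that, for each
`k`, the exponent `α_k` satisfies the deletion test — `2α_k` arises only as `α_k + α_k` inside the
current basis `S ∖ {α₁, …, α_{k-1}}`, and `p_{2α_k} = 0` («The main step in the iteration is the
search for equations that directly constrain a diagonal entry `Q_{i,i}` to be zero (Step 6) … The
iteration continues until no new zero diagonal entries of `Q` are discovered»).  Löfberg: «the
reduction can be applied iteratively». [cite: SeilerZhengBalas2013, §4 Theorem 3 (the zero diagonal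
algorithm)]
[cite: Lofberg2009, §III-B Theorem 2] -/
def IsPruningSeq [DecidableEq σ] (p : MvPolynomial σ R) :
    Finset (σ →₀ ℕ) → List (σ →₀ ℕ) → Prop
  | _, [] => True
  | S, α :: l => UniqueSq S α ∧ coeff (α + α) p = 0 ∧ IsPruningSeq p (S.erase α) l

/-! ### Consequences over an ordered ring -/

variable {𝕜 : Type*} [CommRing 𝕜] [LinearOrder 𝕜] [IsStrictOrderedRing 𝕜]

/-- **Theorem 2 / Lemma 2 (zero diagonal ⇒ the monomial is redundant)**, over a linearly ordered
ring: if `p = Σ_{j ∈ s} u_j²` with every `u_j` supported in `S`, `UniqueSq S α`, and `p_{2α} = 0`,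
then `(u_j)_α = 0` for every `j` (a sum of squares `Σ_j (u_j)_α²` vanishes only termwise).
[cite: Lofberg2009, §III-B Theorem 2] [cite: SeilerZhengBalas2013, §4 Lemma 2, Theorem 3] -/
theorem coeff_eq_zero_of_sum_mul_self_eq {S : Finset (σ →₀ ℕ)} {α : σ →₀ ℕ} (hα : UniqueSq S α)
    {ι : Type*} {s : Finset ι} {u : ι → MvPolynomial σ 𝕜} (hu : ∀ j ∈ s, (u j).support ⊆ S)
    {p : MvPolynomial σ 𝕜} (hp : p = ∑ j ∈ s, u j * u j) (h0 : coeff (α + α) p = 0) :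
    ∀ j ∈ s, coeff α (u j) = 0 := by
  have hsum : ∑ j ∈ s, coeff α (u j) * coeff α (u j) = 0 := by
    rw [← coeff_add_self_sum_mul_self_of_uniqueSq hα s u hu, ← hp, h0]
  intro j hj
  exact mul_self_eq_zero.1
    ((Finset.sum_eq_zero_iff_of_nonneg fun i _ => mul_self_nonneg (coeff α (u i))).1 hsum j hj)

/-- **The pruning step is lossless**: under the hypotheses of `coeff_eq_zero_of_sum_mul_self_eq`
every `u_j` is supported in `S ∖ {α}` (Löfberg, Example 2: the monomial «can be omitted»; SZB:
«`zᵢ` can be removed from `z`»).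
[cite: Lofberg2009, §III-B Theorem 2] [cite: SeilerZhengBalas2013, §4 Lemma 2, Theorem 3] -/
theorem support_subset_erase_of_sum_mul_self_eq [DecidableEq σ] {S : Finset (σ →₀ ℕ)}
    {α : σ →₀ ℕ} (hα : UniqueSq S α) {ι : Type*} {s : Finset ι} {u : ι → MvPolynomial σ 𝕜}
    (hu : ∀ j ∈ s, (u j).support ⊆ S) {p : MvPolynomial σ 𝕜} (hp : p = ∑ j ∈ s, u j * u j)
    (h0 : coeff (α + α) p = 0) : ∀ j ∈ s, (u j).support ⊆ S.erase α := by
  intro j hj β hβ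
  refine Finset.mem_erase.2 ⟨?_, hu j hj hβ⟩
  rintro rfl
  exact (mem_support_iff.1 hβ) (coeff_eq_zero_of_sum_mul_self_eq hα hu hp h0 j hj)

/-- The same with the hypothesis in Löfberg's form «the squared candidate monomial is not a term
in `f(x)`»: `2α ∉ supp p`. [cite: Lofberg2009, §III-B Theorem 2] -/
theorem support_subset_erase_of_notMem_support [DecidableEq σ] {S : Finset (σ →₀ ℕ)}
    {α : σ →₀ ℕ} (hα : UniqueSq S α) {ι : Type*} {s : Finset ι} {u : ι → MvPolynomial σ 𝕜}
    (hu : ∀ j ∈ s, (u j).support ⊆ S) {p : MvPolynomial σ 𝕜} (hp : p = ∑ j ∈ s, u j * u j)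
    (h0 : α + α ∉ p.support) : ∀ j ∈ s, (u j).support ⊆ S.erase α :=
  support_subset_erase_of_sum_mul_self_eq hα hu hp (notMem_support_iff.1 h0)

/-- **Theorem 3 (the zero diagonal algorithm is lossless)**: «if `p = Σᵢ fᵢ²` then
`C(fᵢ) ∩ ℕⁿ ⊆ M_{k_f}`» — along any run of the algorithm started from a basis `S` containing the
supports of the `u_j`, every `u_j` stays supported in the pruned basis («Induction can be used to
show `C(fᵢ) ∩ ℕⁿ ⊆ M_k` holds after each step `k` including the final step `k_f`»).
[cite: SeilerZhengBalas2013, §4 Theorem 3] [cite: Lofberg2009, §III-B Theorem 2] -/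
theorem support_subset_pruneBasis [DecidableEq σ] {p : MvPolynomial σ 𝕜} {ι : Type*}
    {s : Finset ι} {u : ι → MvPolynomial σ 𝕜} (hp : p = ∑ j ∈ s, u j * u j) :
    ∀ (l : List (σ →₀ ℕ)) (S : Finset (σ →₀ ℕ)), IsPruningSeq p S l →
      (∀ j ∈ s, (u j).support ⊆ S) → ∀ j ∈ s, (u j).support ⊆ pruneBasis S l
  | [], _, _, hu => by simpa using hu
  | α :: l, S, ⟨hα, h0, hl⟩, hu => by
    rw [pruneBasis_cons]
    exact support_subset_pruneBasis hp l (S.erase α) hl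
      (support_subset_erase_of_sum_mul_self_eq hα hu hp h0)

/-- **The reduced Gram program is feasible** (Lemma 2 iterated, over `ℝ`): if `p = Σ_j u_j²` with
the `u_j` supported in `S`, then after any run of the zero diagonal algorithm `p = z_Tᵀ Q z_T` for
the pruned basis `T = pruneBasis S l` and some `Q ⪰ 0` («an SOS decomposition of `p`, if one
exists, does not depend on the monomial `zᵢ` and `zᵢ` can be removed from `z`»).
[cite: SeilerZhengBalas2013, §4 Lemma 2, Theorem 3] [cite: Laurent2008, §3.3 Lemma 3.8] -/
theorem exists_posSemidef_gram_pruneBasis {σ : Type*} [DecidableEq σ] {p : MvPolynomial σ ℝ}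
    {ι : Type*} [Fintype ι] {u : ι → MvPolynomial σ ℝ} (hp : p = ∑ j, u j * u j)
    {S : Finset (σ →₀ ℕ)} (hu : ∀ j, (u j).support ⊆ S) {l : List (σ →₀ ℕ)}
    (hl : IsPruningSeq p S l) :
    ∃ Q : Matrix (pruneBasis S l) (pruneBasis S l) ℝ,
      Q.PosSemidef ∧ p = gramPoly Q (monomialVec (pruneBasis S l)) := by
  have hT : ∀ j, (u j).support ⊆ pruneBasis S l := fun j =>
    support_subset_pruneBasis hp l S hl (fun j _ => hu j) j (Finset.mem_univ j)
  refine ⟨(coeffMatrix u (pruneBasis S l))ᵀ * coeffMatrix u (pruneBasis S l), ?_, ?_⟩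
  · simpa only [conjTranspose_eq_transpose_of_trivial] using
      posSemidef_conjTranspose_mul_self (coeffMatrix u (pruneBasis S l))
  · rw [hp]
    exact sum_mul_self_eq_gramPoly u _ hT

/-- **The zero diagonal algorithm on the standard basis `ℕⁿ_d`** (over `ℝ`): a sum of squares `p`
of degree `≤ 2d` has a positive semidefinite Gram matrix on the PRUNED basis
`pruneBasis ℕⁿ_d l` for every run `l` of the algorithm (the SDP actually solved by SOSOPT/YALMIP).
[cite: SeilerZhengBalas2013, §4 Theorem 3] [cite: Lofberg2009, §III-B Theorem 2]
[cite: Laurent2008, §3.3 Lemma 3.8] -/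
theorem exists_posSemidef_gram_pruneBasis_of_isSumSq {σ : Type*} [Fintype σ] [DecidableEq σ]
    {p : MvPolynomial σ ℝ} {d : ℕ} (hdeg : p.totalDegree ≤ 2 * d) (hsos : IsSumSq p)
    {l : List (σ →₀ ℕ)} (hl : IsPruningSeq p (monomialsLE σ d) l) :
    ∃ Q : Matrix (pruneBasis (monomialsLE σ d) l) (pruneBasis (monomialsLE σ d) l) ℝ,
      Q.PosSemidef ∧ p = gramPoly Q (monomialVec (pruneBasis (monomialsLE σ d) l)) := by
  obtain ⟨m, u, hu, hdeg'⟩ := exists_sum_mul_self_eq_of_isSumSq_of_totalDegree_le hsos hdeg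
  exact exists_posSemidef_gram_pruneBasis hu (fun j => support_subset_monomialsLE (hdeg' j)) hl

/-- Consequently, if a run of the algorithm EMPTIES the basis, `p` is a sum of squares only if
`p = 0`. [cite: SeilerZhengBalas2013, §4 Theorem 3] [cite: Lofberg2009, §III-B Theorem 2] -/
theorem eq_zero_of_isSumSq_of_pruneBasis_eq_empty {σ : Type*} [Fintype σ] [DecidableEq σ]
    {p : MvPolynomial σ ℝ} {d : ℕ} (hdeg : p.totalDegree ≤ 2 * d) (hsos : IsSumSq p)
    {l : List (σ →₀ ℕ)} (hl : IsPruningSeq p (monomialsLE σ d) l)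
    (he : pruneBasis (monomialsLE σ d) l = ∅) : p = 0 := by
  obtain ⟨Q, -, hpQ⟩ := exists_posSemidef_gram_pruneBasis_of_isSumSq hdeg hsos hl
  rw [hpQ, gramPoly]
  have : IsEmpty (pruneBasis (monomialsLE σ d) l) := by
    rw [he]; infer_instance
  simp

end ZeroDiagonal

/-! ## §2 A zero-diagonal fixed point lies in the half Newton polytope -/

section HalfNewton

variable {𝕜 : Type*} [Field 𝕜] [LinearOrder 𝕜] [IsStrictOrderedRing 𝕜] {σ : Type*}

/-- The indicator polynomial `Σ_{β ∈ M} X^β` of a finite set of exponents has support `M`.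
[folklore] -/
private theorem support_sum_monomial_one (M : Finset (σ →₀ ℕ)) :
    (∑ β ∈ M, monomial β (1 : 𝕜)).support = M := by
  classical
  ext γ
  rw [mem_support_iff, coeff_sum]
  simp only [coeff_monomial, Finset.sum_ite_eq', ne_eq, ite_eq_right_iff, one_ne_zero, imp_false,
    not_not]

/-- **Theorem 3, the clause `M_{k_f} ⊆ ½ C(p)`**: if `M` is closed under the zero diagonal rule for
`p` — every `α ∈ M` such that `2α` arises in `M + M` only as `α + α` has `p_{2α} ≠ 0` — then every
point of `M` lies in the half Newton polytope `½ N(p)` («consider a vertex `αᵢ` of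
`conv(M_{k_f})`. If there exists `u, v ∈ conv(M_{k_f})` such that `2αᵢ = u + v` then `u = v = αᵢ`
… By Lemma 1 `Q_{i,i} ≠ 0` since `αᵢ` was not removed … thus `2αᵢ ∈ 𝒜 ⊆ C(p)` … Hence
`M_{k_f} ⊆ conv(M_{k_f}) ⊆ ½C(p)`»).  So the algorithm's output is never larger than the Newton
polytope basis. [cite: SeilerZhengBalas2013, §4 Theorem 3] -/
theorem exponentPt_mem_half_newtonPolytope_of_closed (p : MvPolynomial σ 𝕜) {M : Finset (σ →₀ ℕ)}
    (hM : ∀ α ∈ M, UniqueSq M α → coeff (α + α) p ≠ 0) {α : σ →₀ ℕ} (hα : α ∈ M) :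
    exponentPt 𝕜 α ∈ (2⁻¹ : 𝕜) • newtonPolytope p := by
  classical
  -- the indicator polynomial `q` of `M`: `N(q) = conv(M)`
  set q : MvPolynomial σ 𝕜 := ∑ β ∈ M, monomial β (1 : 𝕜)
  have hsupp : q.support = M := support_sum_monomial_one M
  have hconv : Convex 𝕜 ((2⁻¹ : 𝕜) • newtonPolytope p) := (convex_newtonPolytope p).smul _
  -- every vertex of `N(q)` lies in `½ N(p)`
  have hext : (newtonPolytope q).extremePoints 𝕜 ⊆ (2⁻¹ : 𝕜) • newtonPolytope p := by
    intro e he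
    obtain ⟨γ, hγ, rfl⟩ := extremePoints_newtonPolytope_subset q he
    have hγM : γ ∈ M := by simpa [hsupp] using hγ
    have huniq : UniqueSq M γ := by
      intro β β' hβ hβ' h
      have hβq : exponentPt 𝕜 β ∈ newtonPolytope q :=
        exponentPt_mem_newtonPolytope (by simpa [hsupp] using hβ)
      have hβ'q : exponentPt 𝕜 β' ∈ newtonPolytope q :=
        exponentPt_mem_newtonPolytope (by simpa [hsupp] using hβ')
      have hsum : exponentPt 𝕜 β + exponentPt 𝕜 β' = exponentPt 𝕜 γ + exponentPt 𝕜 γ := by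
        rw [← map_add, ← map_add, h]
      exact exponentPt_injective (eq_of_mem_extremePoints_of_add_eq he hβq hβ'q hsum).1
    have h2γ : γ + γ ∈ p.support := mem_support_iff.2 (hM γ hγM huniq)
    refine ⟨exponentPt 𝕜 (γ + γ), exponentPt_mem_newtonPolytope h2γ, ?_⟩
    show (2⁻¹ : 𝕜) • exponentPt 𝕜 (γ + γ) = exponentPt 𝕜 γ
    rw [map_add, ← two_smul 𝕜 (exponentPt 𝕜 γ), smul_smul, inv_mul_cancel₀ (two_ne_zero' 𝕜),
      one_smul]
  have hNq : newtonPolytope q ⊆ (2⁻¹ : 𝕜) • newtonPolytope p := by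
    rw [← convexHull_extremePoints_newtonPolytope q]
    exact convexHull_min hext hconv
  exact hNq (exponentPt_mem_newtonPolytope (by simpa [hsupp] using hα))

end HalfNewton

/-! ## §3 Sign symmetries and block diagonalisation -/

section SignSymmetry

variable {R : Type*} [CommSemiring R] {σ : Type*} {κ : Type*}

/-- The weight attached to a family `r : κ → σ → ℕ` of candidate sign-symmetries
(`x_i ↦ (-1)^{r_k i} x_i`): variable `i` weighs `(r_k i mod 2)_k`, so that the weight of an exponent
`β` is Löfberg's class `w = Rᵀβ (mod 2)`. [cite: Lofberg2009, §III-C Definition 1, Theorem 3] -/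
def signWeight (r : κ → σ → ℕ) : σ → (κ → ZMod 2) := fun i k => (r k i : ZMod 2)

/-- The class of an exponent: `(weight β)_k = Σ_i β_i r_k i (mod 2) = r_kᵀ β`.
[cite: Lofberg2009, §III-C Theorem 3 (W = RᵀS)] -/
theorem weight_signWeight_apply (r : κ → σ → ℕ) (β : σ →₀ ℕ) (k : κ) :
    Finsupp.weight (signWeight r) β k = ((β.sum fun i n => n * r k i : ℕ) : ZMod 2) := by
  rw [Finsupp.weight_apply, Finsupp.sum, Finsupp.sum, Finset.sum_apply, Nat.cast_sum]
  refine Finset.sum_congr rfl fun i _ => ?_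
  simp [signWeight, nsmul_eq_mul]

/-- **Definition 1 (sign-symmetric polynomial)**: every exponent of `p` has class `0`, i.e.
`r_kᵀ β` is even for all `k` and all `β ∈ supp p` (`f(x) = f(±x)` for each sign pattern `r_k`).
[cite: Lofberg2009, §III-C Definition 1] -/
def IsSignSymmetric (r : κ → σ → ℕ) (p : MvPolynomial σ R) : Prop :=
  IsWeightedHomogeneous (signWeight r) p 0

/-- Definition 1 unfolded: «checking whether `rᵀp_j` is even for all exponents `p_j`».
[cite: Lofberg2009, §III-C Definition 1] -/
theorem isSignSymmetric_iff (r : κ → σ → ℕ) (p : MvPolynomial σ R) :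
    IsSignSymmetric r p ↔ ∀ β ∈ p.support, ∀ k, Even (β.sum fun i n => n * r k i) := by
  simp only [IsSignSymmetric, IsWeightedHomogeneous, mem_support_iff]
  refine forall_congr' fun β => imp_congr_right fun _ => ?_
  rw [funext_iff]
  refine forall_congr' fun k => ?_
  rw [weight_signWeight_apply, Pi.zero_apply, ZMod.natCast_eq_zero_iff_even]

variable (r : κ → σ → ℕ)

/-- The class-`c` part `u^{(c)}` of a polynomial: the terms whose exponents have class `c`
(the sub-vector `v_{I_k}` of candidate monomials). [cite: Lofberg2009, §III-C Theorem 3] -/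
noncomputable def signPart (c : κ → ZMod 2) : MvPolynomial σ R →ₗ[R] MvPolynomial σ R :=
  weightedHomogeneousComponent (signWeight r) c

/-- Coefficients of the class-`c` part. [cite: Lofberg2009, §III-C Theorem 3] -/
theorem coeff_signPart [Fintype κ] [DecidableEq κ] (c : κ → ZMod 2) (u : MvPolynomial σ R)
    (β : σ →₀ ℕ) :
    coeff β (signPart r c u) = if Finsupp.weight (signWeight r) β = c then coeff β u else 0 :=
  coeff_weightedHomogeneousComponent c u β

/-- The class-`c` part is supported on the class-`c` exponents of `u` (so inside `S ∩ I_c` when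
`u` is supported in `S`). [cite: Lofberg2009, §III-C Theorem 3 (the blocks I_k)] -/
theorem support_signPart [Fintype κ] [DecidableEq κ] (c : κ → ZMod 2) (u : MvPolynomial σ R) :
    (signPart r c u).support = u.support.filter fun β => Finsupp.weight (signWeight r) β = c :=
  support_weightedHomogeneousComponent c u

/-- A polynomial is the sum of its class parts. [cite: Lofberg2009, §III-C Theorem 3] -/
theorem sum_signPart [Fintype κ] [DecidableEq κ] (u : MvPolynomial σ R) :
    ∑ c : κ → ZMod 2, signPart r c u = u := by
  rw [← finsum_eq_sum_of_fintype]
  exact sum_weightedHomogeneousComponent (signWeight r) u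

/-- In `(ZMod 2)^κ` every element is its own inverse: `c + c' = 0 ↔ c' = c`. [folklore] -/
private theorem add_eq_zero_iff_eq (c c' : κ → ZMod 2) : c + c' = 0 ↔ c' = c := by
  constructor
  · intro h
    rw [eq_neg_of_add_eq_zero_right h]
    funext k
    exact CharTwo.neg_eq (c k)
  · rintro rfl
    funext k
    exact CharTwo.add_self_eq_zero _

/-- The class-`0` part of a product of class parts: `(u^{(c)} v^{(c')})^{(0)}` is `u^{(c)} v^{(c')}`
if `c' = c` and `0` otherwise («odd terms only are generated by `v_eᵀ(x)Q₁₂v_o(x)`, while even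
terms only are generated by `v_eᵀ(x)Q₁₁v_e(x)` and `v_oᵀ(x)Q₂₂v_o(x)`»).
[cite: Lofberg2009, §III-C (1)–(2)] -/
theorem signPart_zero_mul_signPart [Fintype κ] [DecidableEq κ] (c c' : κ → ZMod 2)
    (u v : MvPolynomial σ R) :
    signPart r 0 (signPart r c u * signPart r c' v) =
      if c' = c then signPart r c u * signPart r c' v else 0 := by
  have hmem : signPart r c u * signPart r c' v ∈
      weightedHomogeneousSubmodule R (signWeight r) (c + c') :=
    (weightedHomogeneousComponent_mem _ u c).mul (weightedHomogeneousComponent_mem _ v c')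
  rw [signPart, weightedHomogeneousComponent_of_mem hmem]
  by_cases h : c' = c
  · rw [if_pos h, if_pos ((add_eq_zero_iff_eq c c').2 h).symm]
  · rw [if_neg h, if_neg fun h0 => h ((add_eq_zero_iff_eq c c').1 h0.symm)]

/-- **Theorem 3 (block diagonalisation), as a polynomial identity.**  If `p = Σ_{j ∈ s} u_j²` is
sign-symmetric with respect to the family `r`, then the cross-class products cancel and
`p = Σ_{j ∈ s} Σ_c (u_j^{(c)})²` — a sum of squares in which every square involves the monomials of
ONE class `I_c` only, i.e. a Gram representation that is block diagonal with one block per class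
(«there is no loss in generality to use a block diagonal decomposition»).  Valid over any
commutative semiring. [cite: Lofberg2009, §III-C Theorem 3, (1)–(2), (6)] -/
theorem eq_sum_signPart_mul_self [Fintype κ] [DecidableEq κ] {ι : Type*} (s : Finset ι)
    (u : ι → MvPolynomial σ R) {p : MvPolynomial σ R} (hp : p = ∑ j ∈ s, u j * u j)
    (hsym : IsSignSymmetric r p) :
    p = ∑ j ∈ s, ∑ c : κ → ZMod 2, signPart r c (u j) * signPart r c (u j) := by
  have hπ : signPart r 0 p = p := hsym.weightedHomogeneousComponent_same
  rw [← hπ, hp, map_sum]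
  refine Finset.sum_congr rfl fun j _ => ?_
  conv_lhs => rw [← sum_signPart r (u j)]
  rw [Finset.sum_mul_sum, map_sum]
  refine Finset.sum_congr rfl fun c _ => ?_
  rw [map_sum, Finset.sum_eq_single c]
  · rw [signPart_zero_mul_signPart, if_pos rfl]
  · intro c' _ hc'
    rw [signPart_zero_mul_signPart, if_neg hc']
  · intro h; exact absurd (Finset.mem_univ c) h

/-- **The block SDP (eq. (6))**, over `ℝ`: a sign-symmetric sum of squares `p` of degree `≤ 2d`
has, for every class `c`, a positive semidefinite Gram block `Q_c` on the class-`c` standard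
monomials `I_c = {β ∈ ℕⁿ_d : Rᵀβ ≡ c}` with `p = Σ_c z_{I_c}ᵀ Q_c z_{I_c}` («the SDP will have
three diagonal blocks … The sum-of-squares decomposition can be solved using the following
decomposition (6)»).
[cite: Lofberg2009, §III-C Theorem 3, Example 4 eq. (6)] [cite: Laurent2008, §3.3 Lemma 3.8] -/
theorem exists_posSemidef_gram_blocks {σ : Type*} [Fintype σ] [DecidableEq σ] [Fintype κ]
    [DecidableEq κ] (r : κ → σ → ℕ) {p : MvPolynomial σ ℝ} {d : ℕ}
    (hdeg : p.totalDegree ≤ 2 * d) (hsos : IsSumSq p) (hsym : IsSignSymmetric r p) :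
    ∃ Q : ∀ c : κ → ZMod 2,
        Matrix ((monomialsLE σ d).filter fun β => Finsupp.weight (signWeight r) β = c)
          ((monomialsLE σ d).filter fun β => Finsupp.weight (signWeight r) β = c) ℝ,
      (∀ c, (Q c).PosSemidef) ∧
        p = ∑ c, gramPoly (Q c) (monomialVec
          ((monomialsLE σ d).filter fun β => Finsupp.weight (signWeight r) β = c)) := by
  obtain ⟨m, u, hu, hdeg'⟩ := exists_sum_mul_self_eq_of_isSumSq_of_totalDegree_le hsos hdeg
  have hS : ∀ c j, (signPart r c (u j)).support ⊆
      (monomialsLE σ d).filter fun β => Finsupp.weight (signWeight r) β = c := by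
    intro c j
    rw [support_signPart]
    exact Finset.filter_subset_filter _ (support_subset_monomialsLE (hdeg' j))
  refine ⟨fun c => (coeffMatrix (fun j => signPart r c (u j)) _)ᵀ *
      coeffMatrix (fun j => signPart r c (u j)) _, fun c => ?_, ?_⟩
  · simpa only [conjTranspose_eq_transpose_of_trivial] using
      posSemidef_conjTranspose_mul_self (coeffMatrix (fun j => signPart r c (u j))
        ((monomialsLE σ d).filter fun β => Finsupp.weight (signWeight r) β = c))
  · rw [eq_sum_signPart_mul_self r Finset.univ u hu hsym, Finset.sum_comm]
    exact Finset.sum_congr rfl fun c _ =>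
      sum_mul_self_eq_gramPoly (fun j => signPart r c (u j)) _ (hS c)

end SignSymmetry

/-! ## §4 Post-processing: an exact certificate from an inexact Gram matrix -/

section PostProcessing

open Literature.LinearAlgebra.Matrix (IsDiagDominant)

variable {n : Type*} [Fintype n] [DecidableEq n]

/-- Gershgorin margin: a symmetric matrix whose absolute row sums are at most `c` becomes
diagonally dominant after adding `c·1`. [cite: Lofberg2009, §IV Theorem 4 (proof: ‖R‖ ≤ Mε)] -/
theorem isDiagDominant_add_smul_one {E : Matrix n n ℝ} {c : ℝ} (hrow : ∀ i, ∑ j, |E i j| ≤ c) :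
    IsDiagDominant (E + c • (1 : Matrix n n ℝ)) := by
  intro i
  have hsplit : ∑ j ∈ univ.erase i, |E i j| = ∑ j, |E i j| - |E i i| := by
    rw [← Finset.sum_erase_add _ _ (Finset.mem_univ i)]; ring
  have hoff : ∑ j ∈ univ.erase i, |(E + c • (1 : Matrix n n ℝ)) i j| =
      ∑ j ∈ univ.erase i, |E i j| := by
    refine Finset.sum_congr rfl fun j hj => ?_
    rw [Matrix.add_apply, Matrix.smul_apply, Matrix.one_apply_ne' (Finset.ne_of_mem_erase hj),
      smul_zero, add_zero]
  rw [hoff, hsplit, Matrix.add_apply, Matrix.smul_apply, Matrix.one_apply_eq, smul_eq_mul, mul_one]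
  linarith [hrow i, neg_abs_le (E i i)]

/-- **Theorem 4, exact form**: if `Q − c·1 ⪰ 0` (the Gram matrix has margin `λ_min(Q) ≥ c`) and the
residual Gram matrix `R` is symmetric with absolute row sums `≤ c` (a bound on its spectral norm),
then `Q + R ⪰ 0` («we conclude that `Q + R` is guaranteed to be positive semidefinite if
`λ_min(Q) ≥ M‖A(Q) − b‖_∞`»). [cite: Lofberg2009, §IV Theorem 4] -/
theorem posSemidef_add_of_sub_smul_one {Q E : Matrix n n ℝ} {c : ℝ}
    (hQ : (Q - c • (1 : Matrix n n ℝ)).PosSemidef) (hE : E.IsSymm) (hrow : ∀ i, ∑ j, |E i j| ≤ c) :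
    (Q + E).PosSemidef := by
  have hsymm : (E + c • (1 : Matrix n n ℝ)).IsSymm := by
    rw [Matrix.IsSymm, transpose_add, transpose_smul, transpose_one, hE.eq]
  have hdd := (isDiagDominant_add_smul_one hrow).posSemidef hsymm
  have := hQ.add hdd
  rwa [sub_add_add_cancel] at this

/-- Theorem 4 with Löfberg's entrywise hypothesis: `|R_ij| ≤ ε` for all `i, j` and margin
`c = M ε`, `M` the number of candidate monomials. [cite: Lofberg2009, §IV Theorem 4] -/
theorem posSemidef_add_of_entry_le {Q E : Matrix n n ℝ} {ε : ℝ}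
    (hQ : (Q - (Fintype.card n * ε) • (1 : Matrix n n ℝ)).PosSemidef) (hE : E.IsSymm)
    (hentry : ∀ i j, |E i j| ≤ ε) : (Q + E).PosSemidef :=
  posSemidef_add_of_sub_smul_one hQ hE fun i =>
    (Finset.sum_le_sum fun j _ => hentry i j).trans (by simp)

variable {σ : Type*}

omit [DecidableEq n] in
/-- `gramPoly` is additive in the matrix. [folklore] -/
private theorem gramPoly_add (Q E : Matrix n n ℝ) (z : n → MvPolynomial σ ℝ) :
    gramPoly (Q + E) z = gramPoly Q z + gramPoly E z := by
  simp only [gramPoly, Matrix.add_apply, map_add, add_mul, Finset.sum_add_distrib]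

/-- **Post-processing certificate for the polynomial**: if `p = zᵀQz + zᵀRz` exactly (numerical
Gram matrix plus residual in Gram form), `Q − c·1 ⪰ 0` and `R` is symmetric with absolute row sums
`≤ c`, then `p = zᵀ(Q + R)z` with `Q + R ⪰ 0`, so `p` is a sum of squares («if the Gramian `Q` is
sufficiently positive definite, the polynomial is certifiably non-negative, even though the SDP
solver failed to compute an exact decomposition»).
[cite: Lofberg2009, §IV Theorem 4] [cite: Laurent2008, §3.3 Lemma 3.8] -/
theorem isSumSq_of_gram_add_residual {Q E : Matrix n n ℝ} {c : ℝ} (z : n → MvPolynomial σ ℝ)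
    {p : MvPolynomial σ ℝ} (hp : p = gramPoly Q z + gramPoly E z)
    (hQ : (Q - c • (1 : Matrix n n ℝ)).PosSemidef) (hE : E.IsSymm) (hrow : ∀ i, ∑ j, |E i j| ≤ c) :
    IsSumSq p := by
  rw [hp, ← gramPoly_add]
  exact isSumSq_gramPoly_of_posSemidef (posSemidef_add_of_sub_smul_one hQ hE hrow) z

end PostProcessing

end Literature.Algebra.Polynomial.SosProgramSimplification
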